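import Summits.QuantumFields.BalabanUV.T4Continuum.Support.CTSmallFieldThreshold

/-!
# T⁴ programme, spine node NE2 (U1a), sub-row Δ3 «NE2-WALK» (T4-DAG `T4-U1a.S-NE2-D3-WALK°`) — ROOT B IN THE DECAY CURRENCY DISPLAYING EXACTLY
# THE END OF RECORD's BINDERS: `hdec` FED by the «Δ3-CT» chain at the rate `kappaCT(|o|, d, a, a′)` below the threshold `etaCT(|o|, d, a, a′) ≤ η⋆`

NE2 formalisation swarm `b2b-balaban-t4-ne2-formalise-*`, leaf prover 06 (gen 4), supplier item «Δ3-CT-EXPLICIT» file 3 of 4 (file 1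
`CTAdmissibleRate`: `kappaCT`; file 2 `CTSmallFieldThreshold`: `etaCT₀`, `etaCT`, `couplingSum_le_half`; chain «Δ3-CT» p220700 … p227253).
The owner's `Spine/NE2BalabanDecayRate.balaban_final_decayStations_of_regular` (p218845) turns ROOT B (operator-norm `TowerLimitRate` of Bałaban's
typed perturbed King tower, binders `hreg`, `hNE3`, `a′ > 0`, `α, β ≤ η ≤ η⋆`, `‖t‖ ≤ 1`) plus ONE displayed level-uniform entry-decay input `hdec`
into King's (4.38) decay stations.  Gen 3's chain fed `hdec` modulo nine numeric binders; files 1–2 discharge them.  THIS FILE assembles: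
 * §1 `BCT co d a a′ = 2·(γ_D − J₀)⁻¹·e^{2κ_CT}` (`J₀ = max (JA d a 1 κ_CT 1) 0`), `BCT_pos`; **`numericBinders_CT`** (gen 3's nine numeric binders
   below the threshold, the census in kernel form); **`hdec_balabanPert_CT (hd) (hreg) (ha′) (hαη) (hβη)
   (hη : η ≤ etaCT o d a a′) (ht : ‖t‖ ≤ 1) : ∀ k, EntryDecay distKC (pertCovC (balabanPert (liftR Rg) (gaugeSlot Rg …)) t k) BCT kappaCT`** —
   gen 3's `hdec_balabanPert_of_regular_small` (a″ = 1) + `hP4diff_gaugeSlot_of_regular` + `conjDefect_calDalev_rho` BY NAME, every numeric binder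
   supplied by `kappaCT_spec` ∕ `etaCT₀_spec` ∕ `couplingSum_le_half`, the amplitude made CONSTANT by `EntryDecay.mono` (`(1 − ‖t‖K)⁻¹ ≤ 2`);
 * §2 **`balaban_final_decayStations_of_regular_CT (hL) (hd) (hreg) (hC) (hNE3) (ha′) (hαη) (hβη) (hη : η ≤ etaCT o d a a′) (ht : ‖t‖ ≤ 1)`** = the
   owner's three decay stations (limit entry decay `(BCT, κ_CT)`; King's shapes `(√(2·BCT·C_B(t)/(1−L⁻¹)), κ_CT/2, √(L⁻¹))`, `(√(2·BCT·2C_B(t)/(1−L⁻¹)),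
   κ_CT/2, √(L⁻¹))` against `distKC`) with NO `hdec` and NO numeric binder: the displayed binders are EXACTLY those of ROOT B's END of record
   (`NE2BalabanThreshold.balaban_final_rate_of_regular`) with the threshold `etaStar` replaced by `etaCT = min etaStar etaCT₀ ≤ etaStar`;
   **`balaban_final_twoLevelDecayRate_one_CT`**: the literal King (4.38) ∕ `EtaRateIneqUnit` display at the physical coupling `t = 1`
   (the owner's `balaban_final_twoLevelDecayRate_one` BY NAME) — `∃ B₀, ‖(c_{k+1} − c_k)(x,y)‖ ≤ B₀·(√(L⁻¹))^k·e^{−(κ_CT/2)·distKC(x,y)}`.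

HONEST FRAMING (T4-DAG p. 1).  Bookkeeping over landed modules ([folklore]); statements and constants OURS; MODEL level throughout (transporters `Rg`
DATA in the (3.35)-shape class, canonical site transports `siteT Rg`, King ∕ line-sum averagings; no B0 identification with [B9] (3.23)–(3.26) as
printed; not position-space decay of Bałaban's kernels as printed in [B9] (3.54)–(3.56)); the rate `kappaCT` and the threshold `etaCT` EXIST as definite
functions of `(|o|, d, a, a′)` (continuity at 0 of closed forms) and are NOT extracted as numbers; ROOT B and hence every station here is CONDITIONAL on
node NE3's `LocalRate` BY NAME (`hNE3`, OPEN) and on the regularity class (`hreg`); sub-row Δ3 is thereby fed AT MODEL LEVEL for the typed tier-B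
operator — it is NOT a spine row and this is NOT «NE2 proved»; NE2 (U1a) NOT PROVED; spine PROVED 0/9 unchanged; NOT infinite volume, NOT a mass
gap, NOT the Clay problem, NOT summit progress.  HONEST DEPENDENCY: continuum YM on T⁴ ⇐ BetaPertH ∧ nine spine estimates (0/9 proved); BetaPertH ⇐
(D1) ∧ (D4) ∧ CAP+tail; G-an2-4 gates asym, D1 and NE2/3/4.  ABSOLUTE RULE kept; no `def … : Prop`; no `sorry`.
-/

noncomputable section

open scoped BigOperators ComplexConjugate Matrix Matrix.Norms.L2Operator Kronecker

namespace Summit.QuantumFields.BalabanUV.T4Continuum.CTDecayEnd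

open Literature.MathematicalPhysics.QuantumFieldTheory.Balaban1983to89.B5Prop11Plancherel (Cst Tor fine)
open Literature.MathematicalPhysics.QuantumFieldTheory.Balaban1983to89.B5G183RateUnitTower (lev)
open Literature.MathematicalPhysics.QuantumFieldTheory.Balaban1983to89.T4EtaRateMin (LocalRate)
open Summit.QuantumFields.BalabanUV.T4Continuum
open Summit.QuantumFields.BalabanUV.T4Continuum.BalabanAveragedTowerUnit (idx)
open Summit.QuantumFields.BalabanUV.T4Continuum.BackgroundResolventTower
open Summit.QuantumFields.BalabanUV.T4Continuum.KingPairingPlantedLaw (CJ)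
open Summit.QuantumFields.BalabanUV.T4Continuum.GramPerturbationLaw (C2gram)
open Summit.QuantumFields.BalabanUV.T4Continuum.NE2FromNE3 (bgReadings)
open Summit.QuantumFields.BalabanUV.T4Continuum.NE2ColourPerturbedLayer (pertCovC pertLimC)
open Summit.QuantumFields.BalabanUV.T4Continuum.RegularBackgroundTower (RegularTransporters regClass betaNE3)
open Summit.QuantumFields.BalabanUV.T4Continuum.GaugeTermScalarData (QuT Q1)
open Summit.QuantumFields.BalabanUV.T4Continuum.RegularSiteTransporters (siteT)
open Summit.QuantumFields.BalabanUV.T4Continuum.NestedContourTransport (theta0)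
open Summit.QuantumFields.BalabanUV.T4Continuum.NE2BalabanRoot (balabanPert)
open Summit.QuantumFields.BalabanUV.T4Continuum.NE2BalabanGauge (gaugeSlot liftR)
open Summit.QuantumFields.BalabanUV.T4Continuum.NE2BalabanLayerSharp (kappaBs C2Bs)
open Summit.QuantumFields.BalabanUV.T4Continuum.NE2BalabanWiring (epsR CdeltaR)
open Summit.QuantumFields.BalabanUV.T4Continuum.NE2BalabanFinal (kappa4F C4F)
open Summit.QuantumFields.BalabanUV.T4Continuum.NE2BalabanThreshold (etaStar)
open Summit.QuantumFields.BalabanUV.T4Continuum.NE2BalabanDecayRate (balaban_final_decayStations_of_regular balaban_final_twoLevelDecayRate_one)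
open Summit.QuantumFields.BalabanUV.T4Continuum.DecayRateInterpolation (EntryDecay DecayRate TwoLevelDecayRate)
open Summit.QuantumFields.BalabanUV.T4Continuum.ScalarAveragedPropagator (gammaPs)
open Summit.QuantumFields.BalabanUV.T4Continuum.ScalarAveragedCompression (sigma0)
open Summit.QuantumFields.BalabanUV.T4Continuum.ScalarCovariantCoercive (gammaU Jcov)
open Summit.QuantumFields.BalabanUV.T4Continuum.CTScalarGreen (Jfree)
open Summit.QuantumFields.BalabanUV.T4Continuum.CTGaugeTerm (deltaK)
open Summit.QuantumFields.BalabanUV.T4Continuum.CTVectorPropagator (JA)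
open Summit.QuantumFields.BalabanUV.T4Continuum.CTGaugeUnitFactorHbd (deltaKU)
open Summit.QuantumFields.BalabanUV.T4Continuum.CTGaugeUnitDatum (deltaKB)
open Summit.QuantumFields.BalabanUV.T4Continuum.CTKingTowerWeights (distKC)
open Summit.QuantumFields.BalabanUV.T4Continuum.CTCovariantLaplacianDecay (kappaColCT)
open Summit.QuantumFields.BalabanUV.T4Continuum.CTAveragingSummandHbd (kappaAvgCT)
open Summit.QuantumFields.BalabanUV.T4Continuum.CTConjDefectDischarge (conjDefect_calDalev_rho max_JA_lt_gamD hdec_balabanPert_of_regular_small)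
open Summit.QuantumFields.BalabanUV.T4Continuum.CTGaugeSlotDiff (kappa4CTd hP4diff_gaugeSlot_of_regular)
open Summit.QuantumFields.BalabanUV.T4Continuum.DirichletRegionTower (gamD gamD_pos)
open Summit.QuantumFields.BalabanUV.T4Continuum.CTAdmissibleRate (kappaCT kappaCT_spec kappaCT_pos)
open Summit.QuantumFields.BalabanUV.T4Continuum.CTSmallFieldThreshold (etaCT₀ etaCT₀_spec etaCT etaCT_le_etaStar etaCT_le_etaCT₀ couplingSum_le_half)

variable {d : ℕ} (L : ℕ) [NeZero L] (M : Fin d → ℕ) [hM : ∀ μ, NeZero (M μ)] (a : ℝ) (ha : 0 < a)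
variable {o : Type*} [Fintype o] [DecidableEq o]

/-! ## §1 The constant amplitude and the decay binder with every numeric condition discharged -/

/-- **THE ENTRY-DECAY AMPLITUDE OF RECORD** `BCT(|o|, d, a, a′) = 2·(γ_D − J₀)⁻¹·e^{2κ_CT}`, `J₀ = max (JA d a 1 κ_CT 1) 0` — background- and
coupling-FREE (the factor `2` absorbs `(1 − ‖t‖K)⁻¹` below the threshold). [folklore] -/
def BCT (co d : ℕ) (a a' : ℝ) : ℝ :=
  2 * (gamD d a - max (JA d a 1 (kappaCT co d a a') 1) 0)⁻¹ * Real.exp (kappaCT co d a a' * 2)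

/-- `0 < BCT` (`a′ > 0`). [folklore] -/
theorem BCT_pos (co d : ℕ) (a : ℝ) {a' : ℝ} (ha' : 0 < a') : 0 < BCT co d a a' := by
  have hγ : 0 < gamD d a - max (JA d a 1 (kappaCT co d a a') 1) 0 := sub_pos.mpr (max_JA_lt_gamD a (kappaCT_spec co d a ha').2.2.2.2.1)
  unfold BCT; positivity

omit [NeZero L] hM in
/-- **GEN 3's NINE NUMERIC BINDERS BELOW THE THRESHOLD** (the census in kernel form): on the (3.35)-class with `α, β ≤ η ≤ etaCT o d a a′` and
`‖t‖ ≤ 1`, at `(a″, κ, J) = (1, kappaCT, max (JA d a 1 kappaCT 1) 0)`: `0 < κ`, `Jfree < γ′`, `deltaK < σ₀²`, `JA < γ_D`, `hγ`, `hγ1`, `hδU`, `hδ1`, and the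
coupling product `‖t‖·(κ_CT + κ_avg,CT + kappa4CTd) ≤ 1/2` — exactly the extra hypotheses of `CTGaugeSlotDiff.balaban_final_decayStations_of_regular_smallField`
(with room `1/2` in the last). [folklore] -/
theorem numericBinders_CT {Rg : (k : ℕ) → Fin d → (Tor (fine (lev L k) M) → Matrix o o ℂ)} {α β : ℝ}
    (hreg : RegularTransporters L M (liftR L M Rg) α β) {a' : ℝ} (ha' : 0 < a') {η : ℝ} (hαη : α ≤ η) (hβη : β ≤ η)
    (hη : η ≤ etaCT o d a a') {t : ℂ} (ht : ‖t‖ ≤ 1) :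
    0 < kappaCT (Fintype.card o) d a a' ∧
    Jfree d 1 (kappaCT (Fintype.card o) d a a') 1 < gammaPs d 1 ∧
    deltaK d 1 (kappaCT (Fintype.card o) d a a') 1 < sigma0 d 1 ^ 2 ∧
    JA d a 1 (kappaCT (Fintype.card o) d a a') 1 < gamD d a ∧
    0 < gammaU d a' α (Real.exp ((d + 1 : ℕ) * α) - 1)
      - Jcov (Fintype.card o) d a' α (Real.exp ((d + 1 : ℕ) * α) - 1) (kappaCT (Fintype.card o) d a a') ∧
    0 < gammaU d a' 0 0 - Jcov (Fintype.card o) d a' 0 0 (kappaCT (Fintype.card o) d a a') ∧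
    deltaKU (Fintype.card o) d a' α (Real.exp ((d + 1 : ℕ) * α) - 1) (kappaCT (Fintype.card o) d a a')
      < sigma0 d a' ^ 2 - deltaKB d a' α (Real.exp ((d + 1 : ℕ) * α) - 1) ∧
    deltaKU (Fintype.card o) d a' 0 0 (kappaCT (Fintype.card o) d a a') < sigma0 d a' ^ 2 ∧
    ‖t‖ * (kappaColCT o d a α β (d * (α ^ 2 + 2 * β)) (max (JA d a 1 (kappaCT (Fintype.card o) d a a') 1) 0) (kappaCT (Fintype.card o) d a a')
      + kappaAvgCT (Fintype.card o) d a α (max (JA d a 1 (kappaCT (Fintype.card o) d a a') 1) 0) (kappaCT (Fintype.card o) d a a')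
      + kappa4CTd (Fintype.card o) d a a' α (max (JA d a 1 (kappaCT (Fintype.card o) d a a') 1) 0) (kappaCT (Fintype.card o) d a a'))
      ≤ 1 / 2 := by
  obtain ⟨hκ0, -, hγ', hδ', hJA, hγ1, hδ1⟩ := kappaCT_spec (Fintype.card o) d a ha'
  have hα : 0 ≤ α := hreg.nonneg.1
  have hβ : 0 ≤ β := hreg.nonneg.2
  have hαT : α ≤ etaCT₀ (Fintype.card o) d a a' := hαη.trans (hη.trans (etaCT_le_etaCT₀ o d a a'))
  have hβT : β ≤ etaCT₀ (Fintype.card o) d a a' := hβη.trans (hη.trans (etaCT_le_etaCT₀ o d a a'))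
  obtain ⟨-, -, hall⟩ := etaCT₀_spec (Fintype.card o) d a ha'
  obtain ⟨hγ, hδU, -⟩ := hall α hα hαT
  have hsum := couplingSum_le_half o d a ha' hα hβ hαT hβT
  refine ⟨hκ0, hγ', hδ', hJA, hγ, hγ1, hδU, hδ1, ?_⟩
  rcases le_total 0 (kappaColCT o d a α β (d * (α ^ 2 + 2 * β)) (max (JA d a 1 (kappaCT (Fintype.card o) d a a') 1) 0)
      (kappaCT (Fintype.card o) d a a')
      + kappaAvgCT (Fintype.card o) d a α (max (JA d a 1 (kappaCT (Fintype.card o) d a a') 1) 0) (kappaCT (Fintype.card o) d a a')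
      + kappa4CTd (Fintype.card o) d a a' α (max (JA d a 1 (kappaCT (Fintype.card o) d a a') 1) 0) (kappaCT (Fintype.card o) d a a'))
    with hK0 | hK0
  · exact (mul_le_mul_of_nonneg_right ht hK0).trans (by rw [one_mul]; exact hsum)
  · have := mul_nonpos_of_nonneg_of_nonpos (norm_nonneg t) hK0
    linarith

/-- **THE DECAY BINDER OF THE `P_B`-COUPLED TOWER WITH EVERY NUMERIC CONDITION DISCHARGED** (`d ≥ 1`): on the (3.35)-class with background sizes
`α, β ≤ η ≤ etaCT o d a a′` and any coupling `‖t‖ ≤ 1`,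
`∀ k, EntryDecay distKC (pertCovC (balabanPert (liftR Rg) (gaugeSlot Rg (QuT (siteT Rg)) Q1 a′)) t k) BCT kappaCT` — gen 3's
`hdec_balabanPert_of_regular_small` at the auxiliary mass `a″ = 1`, its `hJ`-side numeric binders from `kappaCT_spec`, the gauge slot's `hP₄` from
`hP4diff_gaugeSlot_of_regular` with `hγ hγ1 hδU hδ1` from `kappaCT_spec` ∕ `etaCT₀_spec`, the coupling condition from `couplingSum_le_half`, and the
amplitude made constant by `EntryDecay.mono`.  Model level; NOT NE2. [folklore] -/
theorem hdec_balabanPert_CT (hd : 1 ≤ d) {Rg : (k : ℕ) → Fin d → (Tor (fine (lev L k) M) → Matrix o o ℂ)} {α β : ℝ}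
    (hreg : RegularTransporters L M (liftR L M Rg) α β) {a' : ℝ} (ha' : 0 < a') {η : ℝ} (hαη : α ≤ η) (hβη : β ≤ η)
    (hη : η ≤ etaCT o d a a') {t : ℂ} (ht : ‖t‖ ≤ 1) (k : ℕ) :
    EntryDecay (distKC L M o)
      (pertCovC L M a ha (balabanPert L M a (liftR L M Rg) (gaugeSlot L M Rg (QuT L M o (siteT L M Rg)) (Q1 L M o) a')) t k)
      (BCT (Fintype.card o) d a a') (kappaCT (Fintype.card o) d a a') := by
  obtain ⟨hκ0, hγ', hδ', hJA, hγ, hγ1, hδU, hδ1, htK2⟩ := numericBinders_CT L M a hreg ha' hαη hβη hη ht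
  set K := kappaColCT o d a α β (d * (α ^ 2 + 2 * β)) (max (JA d a 1 (kappaCT (Fintype.card o) d a a') 1) 0) (kappaCT (Fintype.card o) d a a')
      + kappaAvgCT (Fintype.card o) d a α (max (JA d a 1 (kappaCT (Fintype.card o) d a a') 1) 0) (kappaCT (Fintype.card o) d a a')
      + kappa4CTd (Fintype.card o) d a a' α (max (JA d a 1 (kappaCT (Fintype.card o) d a a') 1) 0) (kappaCT (Fintype.card o) d a a') with hKdef
  have htK : ‖t‖ * K < 1 := lt_of_le_of_lt htK2 (by norm_num)
  have hP₄ := hP4diff_gaugeSlot_of_regular L M a ha hd hreg ha' (conjDefect_calDalev_rho L M a ha one_pos hγ' hδ') (max_JA_lt_gamD a hJA)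
    hγ hγ1 hδU hδ1
  have h := hdec_balabanPert_of_regular_small L M a ha hreg one_pos hκ0.le hγ' hδ' hJA hP₄ htK k
  refine h.mono ?_
  -- `(γ_D − J₀)⁻¹·(1 − ‖t‖K)⁻¹·e^{2κ} ≤ 2·(γ_D − J₀)⁻¹·e^{2κ}`
  have hγJ : 0 < gamD d a - max (JA d a 1 (kappaCT (Fintype.card o) d a a') 1) 0 := sub_pos.mpr (max_JA_lt_gamD a hJA)
  have hhalf : (1 : ℝ) / 2 ≤ 1 - ‖t‖ * K := by linarith
  have hinv : (1 - ‖t‖ * K)⁻¹ ≤ 2 := by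
    have := inv_anti₀ (by norm_num : (0 : ℝ) < 1 / 2) hhalf
    rwa [one_div, inv_inv] at this
  calc (gamD d a - max (JA d a 1 (kappaCT (Fintype.card o) d a a') 1) 0)⁻¹ * (1 - ‖t‖ * K)⁻¹ * Real.exp (kappaCT (Fintype.card o) d a a' * 2)
      ≤ (gamD d a - max (JA d a 1 (kappaCT (Fintype.card o) d a a') 1) 0)⁻¹ * 2 * Real.exp (kappaCT (Fintype.card o) d a a' * 2) := by
        gcongr
    _ = BCT (Fintype.card o) d a a' := by rw [BCT]; ring

/-! ## §2 ROOT B's decay stations displaying exactly the END of record's binders -/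

/-- **ROOT B IN THE DECAY CURRENCY, DISPLAYING EXACTLY THE END OF RECORD's BINDERS** (`L ≥ 2`, `d ≥ 1`): the owner's
`NE2BalabanDecayRate.balaban_final_decayStations_of_regular` with its displayed `hdec` FED by `hdec_balabanPert_CT` — binders `hreg` (row B5's
(3.35)-shape class), `hNE3` (node NE3's `LocalRate` BY NAME, OPEN), `0 < a′`, `α ≤ η`, `β ≤ η`, `η ≤ etaCT o d a a′` (`= min η⋆ η_CT ≤ η⋆`), `‖t‖ ≤ 1` —
NOTHING ELSE; rate `κ_CT`, amplitude `BCT` and threshold `etaCT` depend on `(|o|, d, a, a′)` ALONE (uniform in the torus `M`, the scale `L`, the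
level and the coupling): limit entry decay `(BCT, κ_CT)`, King's (4.38) shapes `(√(2·BCT·C_B(t)/(1−L⁻¹)), κ_CT/2, √(L⁻¹))` ∕ `(√(2·BCT·2C_B(t)/(1−L⁻¹)), κ_CT/2,
√(L⁻¹))` against `distKC`.  Model level (no B0); the rate and threshold exist as functions of `(|o|, d, a, a′)` and are not extracted as numbers;
CONDITIONAL on NE3 + the (3.35)-class; NOT [B9] (3.54)–(3.56) as printed; NE2 (U1a) is NOT proved by this. [cite: King1986, Lemma 4.5 (4.38) p.674
(shape); Balaban1985BackgroundPropagators, (3.26) p.395, Thm 3.4 p.400 (shapes)] [folklore] -/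
theorem balaban_final_decayStations_of_regular_CT (hL : 2 ≤ L) (hd : 1 ≤ d)
    {Rg : (k : ℕ) → Fin d → (Tor (fine (lev L k) M) → Matrix o o ℂ)}
    {α β : ℝ} (hreg : RegularTransporters L M (liftR L M Rg) α β) {C : ℝ} (hC : 0 ≤ C)
    (hNE3 : LocalRate (bgReadings L M (regClass L M (liftR L M Rg))) C ((L : ℝ)⁻¹)) {a' : ℝ} (ha' : 0 < a')
    {η : ℝ} (hαη : α ≤ η) (hβη : β ≤ η) (hη : η ≤ etaCT o d a a') {t : ℂ} (ht : ‖t‖ ≤ 1) :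
    EntryDecay (distKC L M o)
        (pertLimC L M a ha (balabanPert L M a (liftR L M Rg) (gaugeSlot L M Rg (QuT L M o (siteT L M Rg)) (Q1 L M o) a')) t)
        (BCT (Fintype.card o) d a a') (kappaCT (Fintype.card o) d a a') ∧
      DecayRate (distKC L M o)
        (pertCovC L M a ha (balabanPert L M a (liftR L M Rg) (gaugeSlot L M Rg (QuT L M o (siteT L M Rg)) (Q1 L M o) a')) t)
        (pertLimC L M a ha (balabanPert L M a (liftR L M Rg) (gaugeSlot L M Rg (QuT L M o (siteT L M Rg)) (Q1 L M o) a')) t)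
        (Real.sqrt (2 * BCT (Fintype.card o) d a a' *
          (Cpert (kappaBs o d a α β (a * (epsR o d α * (2 + epsR o d α) * Cst d a)) (kappa4F d a a' α β)) (2 * d * Cst d a) (CJ d a)
              (C2Bs o d L a α β C
                (a * C2gram (Cst d a) 1 (epsR o d α) (2 * d * Cst d a) (CJ d a) (Cst d a) (CdeltaR o d a α (theta0 d α (betaNE3 o C))))
                (C4F o d L a a' α β C)) 0 t / (1 - (L : ℝ)⁻¹))))
        (kappaCT (Fintype.card o) d a a' / 2) (Real.sqrt ((L : ℝ)⁻¹)) ∧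
      TwoLevelDecayRate (distKC L M o)
        (pertCovC L M a ha (balabanPert L M a (liftR L M Rg) (gaugeSlot L M Rg (QuT L M o (siteT L M Rg)) (Q1 L M o) a')) t)
        (Real.sqrt (2 * BCT (Fintype.card o) d a a' * (2 *
          Cpert (kappaBs o d a α β (a * (epsR o d α * (2 + epsR o d α) * Cst d a)) (kappa4F d a a' α β)) (2 * d * Cst d a) (CJ d a)
              (C2Bs o d L a α β C
                (a * C2gram (Cst d a) 1 (epsR o d α) (2 * d * Cst d a) (CJ d a) (Cst d a) (CdeltaR o d a α (theta0 d α (betaNE3 o C))))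
                (C4F o d L a a' α β C)) 0 t / (1 - (L : ℝ)⁻¹))))
        (kappaCT (Fintype.card o) d a a' / 2) (Real.sqrt ((L : ℝ)⁻¹)) :=
  balaban_final_decayStations_of_regular L M a ha hL hd hreg hC hNE3 ha' hαη hβη (hη.trans (etaCT_le_etaStar o d a a')) ht
    (hdec_balabanPert_CT L M a ha hd hreg ha' hαη hβη hη ht)

/-- **ROOT B IN THE DECAY CURRENCY AT THE PHYSICAL COUPLING `t = 1`, THE LITERAL KING (4.38) ∕ `EtaRateIneqUnit` DISPLAY, NO `hdec`**
(`L ≥ 2`, `d ≥ 1`): `∃ B₀, ‖(c_{k+1} − c_k)(x,y)‖ ≤ B₀·(√(L⁻¹))^k·e^{−(κ_CT/2)·distKC(x,y)}` for the `P_B`-coupled King-averaged covariances at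
`t = 1`, from the END of record's binders with `η ≤ etaCT` ALONE — the owner's `balaban_final_twoLevelDecayRate_one` BY NAME.  Model level;
CONDITIONAL on NE3 + the (3.35)-class + the threshold; NE2 (U1a) NOT proved by this. [cite: King1986, Lemma 4.5 (4.38) p.674 (shape)] [folklore] -/
theorem balaban_final_twoLevelDecayRate_one_CT (hL : 2 ≤ L) (hd : 1 ≤ d)
    {Rg : (k : ℕ) → Fin d → (Tor (fine (lev L k) M) → Matrix o o ℂ)}
    {α β : ℝ} (hreg : RegularTransporters L M (liftR L M Rg) α β) {C : ℝ} (hC : 0 ≤ C)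
    (hNE3 : LocalRate (bgReadings L M (regClass L M (liftR L M Rg))) C ((L : ℝ)⁻¹)) {a' : ℝ} (ha' : 0 < a')
    {η : ℝ} (hαη : α ≤ η) (hβη : β ≤ η) (hη : η ≤ etaCT o d a a') :
    ∃ B₀ : ℝ, ∀ k (x y : idx L M 0 × o),
      ‖(pertCovC L M a ha (balabanPert L M a (liftR L M Rg) (gaugeSlot L M Rg (QuT L M o (siteT L M Rg)) (Q1 L M o) a')) 1 (k + 1)
          - pertCovC L M a ha (balabanPert L M a (liftR L M Rg) (gaugeSlot L M Rg (QuT L M o (siteT L M Rg)) (Q1 L M o) a')) 1 k) x y‖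
        ≤ B₀ * Real.sqrt ((L : ℝ)⁻¹) ^ k * Real.exp (-(kappaCT (Fintype.card o) d a a' / 2 * distKC L M o x y)) := by
  have h1 : ‖(1 : ℂ)‖ ≤ 1 := by rw [norm_one]
  exact balaban_final_twoLevelDecayRate_one L M a ha hL hd hreg hC hNE3 ha' hαη hβη (hη.trans (etaCT_le_etaStar o d a a'))
    (hdec_balabanPert_CT L M a ha hd hreg ha' hαη hβη hη h1)

end Summit.QuantumFields.BalabanUV.T4Continuum.CTDecayEnd

end
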